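/-
COR-CM (cell pub-hodgecm2, stage 2 of the Hodge ladder) — count-neutral KERNEL COMBINATORICS «the binary tetrahedral group SL(2,3)», part VII: the CLOSING FAMILY
`B1` and the SPANNING TREES (seat prover-pub-hodgecm2-b23-g53-0, binder prover b23, gen 53; claim HOME/INBOX.md l.24246, NAME ASK l.24300).  Bookkeeping
definitions with bodies (`faceList`, `famB1`) + theorems; `decide` only on closed identities of `Bool`/`Fin 4`/`Fin 4 → Bool`/`ZMod 3` literals (pattern maps of
gen 44 at literal patterns), no certificate, no named fact, no `sorry`.  The chains of §3 were found by a breadth-first search (this seatʼs `work/gen/trees.py`,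
bytes of record in HOME/pub-hodgecm2-b23/lean-g53/) and are checked here by the kernel.  `Interfaces.lean` (C1), every E term, B01, `Transposition/*`, `PortJoin/*`,
`D2Bridge/*` untouched.  HONEST FRAMING: `HC_CM` is NOT proved, here or anywhere in the tree; nothing here is a period, a count of record or a headline.
T5: n/a-class (no hypothesis binders); checker: self.
-/
import Summits.HodgeConjecture.CorCM.Census.QuarticInversionTrees
import Summits.HodgeConjecture.CorCM.Census.BinaryTetrahedralOrbit

/-!
# The binary tetrahedral group, VII: the closing family `B1` (eight faces) and the spanning trees — every slot binomial lies in its value module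

THE MODEL of `SL(2,3)` is part IVʼs with `A = ℤ/3`, shear `σ = 1`.
* §1 **The closing family `B1`** (EIGHT faces, found by this seatʼs `work/numerics/sl23_b1mix2.py`: the 𝔽₂-coinvariants of the residual value lattice have
  dimension `8`, so eight is least): the square `S = sqFace ∅ 0 1 (F,F,F,T)` and the seven mixed faces `M(i;b) = mixFace {0} 1 i 0 b` for
  `(i;b) ∈ {(1;FTFF), (1;FTFT), (1;FTTF), (1;FTTT), (2;FFTF), (2;FTTF), (3;FFFT)}` — a spanning tree of the eight atom blocks.
* §2 **Edges at the position `(1, 0)`**: the seven binomials of the mixed faces (gen 44ʼs `Avec_mixFace`), those of coordinates `2, 3` moved to coordinate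
  `1` by `k` and `i`; §3 **the spanning tree**: chains join every pattern to the root, so EVERY slot binomial of position `(1, 0)` lies in the value
  module (`toRoot_one_zero`, `all_one_zero`).
* §4 **Every position**: `i`, `k` and the sheared translation `a` carry the complete set of binomials of `(1, 0)` to all twelve positions (`all_bin`).
All [folklore] bookkeeping over [Pohlmann1968, Thm 1].

## References
* [Pohlmann1968] H. Pohlmann, Algebraic cycles on abelian varieties of complex multiplication type, Ann. of Math. 88 (1968), Thm 1.
-/

namespace Summit.HodgeConjecture.CorCM.Census.BinaryTetrahedral

open Finset
open Summit.HodgeConjecture.CorCM.Census.OddSliceFacesModel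
open Summit.HodgeConjecture.CorCM.Census.QuarticInversion

noncomputable section

/-! ## §1 The closing family `B1` -/

/-- `|ℤ/3|` is odd. [folklore] -/
theorem odd_card_zmod_three : Odd (Fintype.card (ZMod 3)) := ⟨1, by simp⟩

/-- `3 ≤ |ℤ/3|`. [folklore] -/
theorem three_le_card_zmod_three : 3 ≤ Fintype.card (ZMod 3) := by simp

/-- `|{0}| = |ℤ/3| / 2`. [folklore] -/
theorem card_singleton_zero : ({0} : Finset (ZMod 3)).card = Fintype.card (ZMod 3) / 2 := by simp

/-- `1 ∉ {0}` in `ℤ/3`. [folklore] -/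
theorem one_notMem_singleton_zero : (1 : ZMod 3) ∉ ({0} : Finset (ZMod 3)) := by decide

/-- **The eight closing faces of `SL(2,3)`**: the square `S` and the seven mixed faces. [folklore] -/
def faceList : Fin 8 → (Ty₄ (ZMod 3) → ℤ) :=
  ![sqFace (ZMod 3) ∅ 0 1 ![false, false, false, true],
    mixFace (ZMod 3) {0} 1 1 0 ![false, true, false, false],
    mixFace (ZMod 3) {0} 1 1 0 ![false, true, false, true],
    mixFace (ZMod 3) {0} 1 1 0 ![false, true, true, false],
    mixFace (ZMod 3) {0} 1 1 0 ![false, true, true, true],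
    mixFace (ZMod 3) {0} 1 2 0 ![false, false, true, false],
    mixFace (ZMod 3) {0} 1 2 0 ![false, true, true, false],
    mixFace (ZMod 3) {0} 1 3 0 ![false, false, false, true]]

/-- **The closing family `B1`** as a finite set. [folklore] -/
def famB1 : Finset (Ty₄ (ZMod 3) → ℤ) := univ.image faceList

/-- `B1` has at most eight members. [folklore] -/
theorem card_famB1_le : famB1.card ≤ 8 := (Finset.card_image_le).trans (by simp)

/-- Listed faces belong to `B1`. [folklore] -/
theorem faceList_mem (k : Fin 8) : faceList k ∈ (↑famB1 : Set (Ty₄ (ZMod 3) → ℤ)) :=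
  Finset.mem_coe.mpr (Finset.mem_image_of_mem _ (Finset.mem_univ k))

/-- `S ∈ B1`. [folklore] -/
theorem mem_S : sqFace (ZMod 3) ∅ 0 1 ![false, false, false, true] ∈ (↑famB1 : Set (Ty₄ (ZMod 3) → ℤ)) := faceList_mem 0
/-- `M1_FTFF ∈ B1`. [folklore] -/
theorem mem_M1_FTFF : mixFace (ZMod 3) {0} 1 1 0 ![false, true, false, false] ∈ (↑famB1 : Set (Ty₄ (ZMod 3) → ℤ)) := faceList_mem 1
/-- `M1_FTFT ∈ B1`. [folklore] -/
theorem mem_M1_FTFT : mixFace (ZMod 3) {0} 1 1 0 ![false, true, false, true] ∈ (↑famB1 : Set (Ty₄ (ZMod 3) → ℤ)) := faceList_mem 2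
/-- `M1_FTTF ∈ B1`. [folklore] -/
theorem mem_M1_FTTF : mixFace (ZMod 3) {0} 1 1 0 ![false, true, true, false] ∈ (↑famB1 : Set (Ty₄ (ZMod 3) → ℤ)) := faceList_mem 3
/-- `M1_FTTT ∈ B1`. [folklore] -/
theorem mem_M1_FTTT : mixFace (ZMod 3) {0} 1 1 0 ![false, true, true, true] ∈ (↑famB1 : Set (Ty₄ (ZMod 3) → ℤ)) := faceList_mem 4
/-- `M2_FFTF ∈ B1`. [folklore] -/
theorem mem_M2_FFTF : mixFace (ZMod 3) {0} 1 2 0 ![false, false, true, false] ∈ (↑famB1 : Set (Ty₄ (ZMod 3) → ℤ)) := faceList_mem 5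
/-- `M2_FTTF ∈ B1`. [folklore] -/
theorem mem_M2_FTTF : mixFace (ZMod 3) {0} 1 2 0 ![false, true, true, false] ∈ (↑famB1 : Set (Ty₄ (ZMod 3) → ℤ)) := faceList_mem 6
/-- `M3_FFFT ∈ B1`. [folklore] -/
theorem mem_M3_FFFT : mixFace (ZMod 3) {0} 1 3 0 ![false, false, false, true] ∈ (↑famB1 : Set (Ty₄ (ZMod 3) → ℤ)) := faceList_mem 7

/-- `B1` consists of Hodge vectors. [folklore] -/
theorem famB1_subset_hodge₄ : (↑famB1 : Set (Ty₄ (ZMod 3) → ℤ)) ⊆ hodge₄ (ZMod 3) := by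
  intro f hf
  rw [Finset.mem_coe, famB1, Finset.mem_image] at hf
  obtain ⟨k, -, rfl⟩ := hf
  fin_cases k
  · exact faceVec₄_mem (ZMod 3) _ (by decide)
  · exact faceVec₄_mem (ZMod 3) _ (by decide)
  · exact faceVec₄_mem (ZMod 3) _ (by decide)
  · exact faceVec₄_mem (ZMod 3) _ (by decide)
  · exact faceVec₄_mem (ZMod 3) _ (by decide)
  · exact faceVec₄_mem (ZMod 3) _ (by decide)
  · exact faceVec₄_mem (ZMod 3) _ (by decide)
  · exact faceVec₄_mem (ZMod 3) _ (by decide)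

/-! ## §2–§3 Edges and the spanning tree at the position `(1, 0)` -/

section Trees


/-- **Every pattern is joined to the root at the position `(1, 0)`**: `binVec 1 a FFFF 0` lies in the value module of `B1`. [folklore] -/
theorem toRoot_one_zero (hA : Odd (Fintype.card (ZMod 3))) (h3 : 3 ≤ Fintype.card (ZMod 3)) (hw : (1 : ZMod 3) ∉ ({0} : Finset (ZMod 3)))
    (hQ : ({0} : Finset (ZMod 3)).card = Fintype.card (ZMod 3) / 2) (a : Fin 4 → Bool) :
    binVec (ZMod 3) 1 a ![false, false, false, false] 0 ∈ valMod (ZMod 3) (1 : ZMod 3) (↑famB1 : Set (Ty₄ (ZMod 3) → ℤ)) := by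
  have ea : a = ![a 0, a 1, a 2, a 3] := by funext n; fin_cases n <;> rfl
  rw [ea]
  have key : ∀ a0 a1 a2 a3 : Bool, binVec (ZMod 3) 1 ![a0, a1, a2, a3] ![false, false, false, false] 0 ∈ valMod (ZMod 3) (1 : ZMod 3) (↑famB1 : Set (Ty₄ (ZMod 3) → ℤ)) := by
    have m1 : binVec (ZMod 3) 1 ![false, false, true, true] ![true, false, true, true] 0 ∈ valMod (ZMod 3) (1 : ZMod 3) (↑famB1 : Set (Ty₄ (ZMod 3) → ℤ)) :=
      mix_mem₀ (ZMod 3) hA h3 hw hQ (i := 1) (by decide) (b := ![false, true, false, false]) (by decide) mem_M1_FTFF (by decide) (by decide)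
    have m2 : binVec (ZMod 3) 1 ![false, false, true, false] ![true, false, true, false] 0 ∈ valMod (ZMod 3) (1 : ZMod 3) (↑famB1 : Set (Ty₄ (ZMod 3) → ℤ)) :=
      mix_mem₀ (ZMod 3) hA h3 hw hQ (i := 1) (by decide) (b := ![false, true, false, true]) (by decide) mem_M1_FTFT (by decide) (by decide)
    have m3 : binVec (ZMod 3) 1 ![false, false, false, true] ![true, false, false, true] 0 ∈ valMod (ZMod 3) (1 : ZMod 3) (↑famB1 : Set (Ty₄ (ZMod 3) → ℤ)) :=
      mix_mem₀ (ZMod 3) hA h3 hw hQ (i := 1) (by decide) (b := ![false, true, true, false]) (by decide) mem_M1_FTTF (by decide) (by decide)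
    have m4 : binVec (ZMod 3) 1 ![false, false, false, false] ![true, false, false, false] 0 ∈ valMod (ZMod 3) (1 : ZMod 3) (↑famB1 : Set (Ty₄ (ZMod 3) → ℤ)) :=
      mix_mem₀ (ZMod 3) hA h3 hw hQ (i := 1) (by decide) (b := ![false, true, true, true]) (by decide) mem_M1_FTTT (by decide) (by decide)
    have m5 : binVec (ZMod 3) 2 ![false, true, false, true] ![true, true, false, true] 0 ∈ valMod (ZMod 3) (1 : ZMod 3) (↑famB1 : Set (Ty₄ (ZMod 3) → ℤ)) :=
      mix_mem₀ (ZMod 3) hA h3 hw hQ (i := 2) (by decide) (b := ![false, false, true, false]) (by decide) mem_M2_FFTF (by decide) (by decide)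
    have m6 : binVec (ZMod 3) 2 ![false, false, false, true] ![true, false, false, true] 0 ∈ valMod (ZMod 3) (1 : ZMod 3) (↑famB1 : Set (Ty₄ (ZMod 3) → ℤ)) :=
      mix_mem₀ (ZMod 3) hA h3 hw hQ (i := 2) (by decide) (b := ![false, true, true, false]) (by decide) mem_M2_FTTF (by decide) (by decide)
    have m7 : binVec (ZMod 3) 3 ![false, true, true, false] ![true, true, true, false] 0 ∈ valMod (ZMod 3) (1 : ZMod 3) (↑famB1 : Set (Ty₄ (ZMod 3) → ℤ)) :=
      mix_mem₀ (ZMod 3) hA h3 hw hQ (i := 3) (by decide) (b := ![false, false, false, true]) (by decide) mem_M3_FFFT (by decide) (by decide)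
    have t8 : binVec (ZMod 3) 0 ![false, false, true, true] ![false, false, false, true] 0 ∈ valMod (ZMod 3) (1 : ZMod 3) (↑famB1 : Set (Ty₄ (ZMod 3) → ℤ)) :=
      T_mem (ZMod 3) hA (j := 2) (by decide) (by decide) (by decide) (by decide) m5
    have z9 : binVec (ZMod 3) 1 ![true, false, false, false] ![true, false, false, true] 0 ∈ valMod (ZMod 3) (1 : ZMod 3) (↑famB1 : Set (Ty₄ (ZMod 3) → ℤ)) :=
      Z_mem' (ZMod 3) hA (j := 0) (by decide) (by decide) (by decide) (by decide) t8
    have t10 : binVec (ZMod 3) 0 ![false, false, true, false] ![false, false, false, false] 0 ∈ valMod (ZMod 3) (1 : ZMod 3) (↑famB1 : Set (Ty₄ (ZMod 3) → ℤ)) :=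
      T_mem (ZMod 3) hA (j := 2) (by decide) (by decide) (by decide) (by decide) m6
    have z11 : binVec (ZMod 3) 1 ![true, false, true, false] ![true, false, true, true] 0 ∈ valMod (ZMod 3) (1 : ZMod 3) (↑famB1 : Set (Ty₄ (ZMod 3) → ℤ)) :=
      Z_mem' (ZMod 3) hA (j := 0) (by decide) (by decide) (by decide) (by decide) t10
    have t12 : binVec (ZMod 3) 1 ![false, false, true, false] ![false, false, false, false] 0 ∈ valMod (ZMod 3) (1 : ZMod 3) (↑famB1 : Set (Ty₄ (ZMod 3) → ℤ)) :=
      T_mem' (ZMod 3) hA (j := 3) (by decide) (by decide) (by decide) (by decide) m7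
    have c0000 : binVec (ZMod 3) 1 ![false, false, false, false] ![false, false, false, false] 0 ∈ valMod (ZMod 3) (1 : ZMod 3) (↑famB1 : Set (Ty₄ (ZMod 3) → ℤ)) := memJ (ZMod 3) _ (a := ![false, false, false, false]) (b := ![false, false, false, false]) (fun _ _ => rfl) 0
    have c1000 : binVec (ZMod 3) 1 ![true, false, false, false] ![false, false, false, false] 0 ∈ valMod (ZMod 3) (1 : ZMod 3) (↑famB1 : Set (Ty₄ (ZMod 3) → ℤ)) := memT (ZMod 3) (memS (ZMod 3) m4) c0000
    have c0010 : binVec (ZMod 3) 1 ![false, false, true, false] ![false, false, false, false] 0 ∈ valMod (ZMod 3) (1 : ZMod 3) (↑famB1 : Set (Ty₄ (ZMod 3) → ℤ)) := memT (ZMod 3) t12 c0000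
    have c0100 : binVec (ZMod 3) 1 ![false, true, false, false] ![false, false, false, false] 0 ∈ valMod (ZMod 3) (1 : ZMod 3) (↑famB1 : Set (Ty₄ (ZMod 3) → ℤ)) := memT (ZMod 3) (memJ (ZMod 3) _ (a := ![false, true, false, false]) (b := ![false, false, false, false]) (by decide) 0) c0000
    have c1001 : binVec (ZMod 3) 1 ![true, false, false, true] ![false, false, false, false] 0 ∈ valMod (ZMod 3) (1 : ZMod 3) (↑famB1 : Set (Ty₄ (ZMod 3) → ℤ)) := memT (ZMod 3) (memS (ZMod 3) z9) c1000
    have c1100 : binVec (ZMod 3) 1 ![true, true, false, false] ![false, false, false, false] 0 ∈ valMod (ZMod 3) (1 : ZMod 3) (↑famB1 : Set (Ty₄ (ZMod 3) → ℤ)) := memT (ZMod 3) (memJ (ZMod 3) _ (a := ![true, true, false, false]) (b := ![true, false, false, false]) (by decide) 0) c1000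
    have c1010 : binVec (ZMod 3) 1 ![true, false, true, false] ![false, false, false, false] 0 ∈ valMod (ZMod 3) (1 : ZMod 3) (↑famB1 : Set (Ty₄ (ZMod 3) → ℤ)) := memT (ZMod 3) (memS (ZMod 3) m2) c0010
    have c0110 : binVec (ZMod 3) 1 ![false, true, true, false] ![false, false, false, false] 0 ∈ valMod (ZMod 3) (1 : ZMod 3) (↑famB1 : Set (Ty₄ (ZMod 3) → ℤ)) := memT (ZMod 3) (memJ (ZMod 3) _ (a := ![false, true, true, false]) (b := ![false, false, true, false]) (by decide) 0) c0010
    have c0001 : binVec (ZMod 3) 1 ![false, false, false, true] ![false, false, false, false] 0 ∈ valMod (ZMod 3) (1 : ZMod 3) (↑famB1 : Set (Ty₄ (ZMod 3) → ℤ)) := memT (ZMod 3) m3 c1001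
    have c1101 : binVec (ZMod 3) 1 ![true, true, false, true] ![false, false, false, false] 0 ∈ valMod (ZMod 3) (1 : ZMod 3) (↑famB1 : Set (Ty₄ (ZMod 3) → ℤ)) := memT (ZMod 3) (memJ (ZMod 3) _ (a := ![true, true, false, true]) (b := ![true, false, false, true]) (by decide) 0) c1001
    have c1011 : binVec (ZMod 3) 1 ![true, false, true, true] ![false, false, false, false] 0 ∈ valMod (ZMod 3) (1 : ZMod 3) (↑famB1 : Set (Ty₄ (ZMod 3) → ℤ)) := memT (ZMod 3) (memS (ZMod 3) z11) c1010
    have c1110 : binVec (ZMod 3) 1 ![true, true, true, false] ![false, false, false, false] 0 ∈ valMod (ZMod 3) (1 : ZMod 3) (↑famB1 : Set (Ty₄ (ZMod 3) → ℤ)) := memT (ZMod 3) (memJ (ZMod 3) _ (a := ![true, true, true, false]) (b := ![true, false, true, false]) (by decide) 0) c1010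
    have c0101 : binVec (ZMod 3) 1 ![false, true, false, true] ![false, false, false, false] 0 ∈ valMod (ZMod 3) (1 : ZMod 3) (↑famB1 : Set (Ty₄ (ZMod 3) → ℤ)) := memT (ZMod 3) (memJ (ZMod 3) _ (a := ![false, true, false, true]) (b := ![false, false, false, true]) (by decide) 0) c0001
    have c0011 : binVec (ZMod 3) 1 ![false, false, true, true] ![false, false, false, false] 0 ∈ valMod (ZMod 3) (1 : ZMod 3) (↑famB1 : Set (Ty₄ (ZMod 3) → ℤ)) := memT (ZMod 3) m1 c1011
    have c1111 : binVec (ZMod 3) 1 ![true, true, true, true] ![false, false, false, false] 0 ∈ valMod (ZMod 3) (1 : ZMod 3) (↑famB1 : Set (Ty₄ (ZMod 3) → ℤ)) := memT (ZMod 3) (memJ (ZMod 3) _ (a := ![true, true, true, true]) (b := ![true, false, true, true]) (by decide) 0) c1011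
    have c0111 : binVec (ZMod 3) 1 ![false, true, true, true] ![false, false, false, false] 0 ∈ valMod (ZMod 3) (1 : ZMod 3) (↑famB1 : Set (Ty₄ (ZMod 3) → ℤ)) := memT (ZMod 3) (memJ (ZMod 3) _ (a := ![false, true, true, true]) (b := ![false, false, true, true]) (by decide) 0) c0011
    intro a0 a1 a2 a3
    cases a0 <;> cases a1 <;> cases a2 <;> cases a3
    · exact c0000
    · exact c0001
    · exact c0010
    · exact c0011
    · exact c0100
    · exact c0101
    · exact c0110
    · exact c0111
    · exact c1000
    · exact c1001
    · exact c1010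
    · exact c1011
    · exact c1100
    · exact c1101
    · exact c1110
    · exact c1111
  exact key (a 0) (a 1) (a 2) (a 3)

/-- **Every slot binomial of the position `(1, 0)` lies in the value module of `B1`.** [folklore] -/
theorem all_one_zero (hA : Odd (Fintype.card (ZMod 3))) (h3 : 3 ≤ Fintype.card (ZMod 3)) (hw : (1 : ZMod 3) ∉ ({0} : Finset (ZMod 3)))
    (hQ : ({0} : Finset (ZMod 3)).card = Fintype.card (ZMod 3) / 2) (a b : Fin 4 → Bool) : binVec (ZMod 3) 1 a b 0 ∈ valMod (ZMod 3) (1 : ZMod 3) (↑famB1 : Set (Ty₄ (ZMod 3) → ℤ)) :=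
  memT (ZMod 3) (toRoot_one_zero hA h3 hw hQ a) (memS (ZMod 3) (toRoot_one_zero hA h3 hw hQ b))

/-! ## §4 Every position -/

/-- **Every slot binomial of EVERY position lies in the value module of `B1`.** [folklore] -/
theorem all_bin (hA : Odd (Fintype.card (ZMod 3))) (h3 : 3 ≤ Fintype.card (ZMod 3)) (hw : (1 : ZMod 3) ∉ ({0} : Finset (ZMod 3)))
    (hQ : ({0} : Finset (ZMod 3)).card = Fintype.card (ZMod 3) / 2) (j : Fin 4) (h h' : Fin 4 → Bool) (u : ZMod 3) :
    binVec (ZMod 3) j h h' u ∈ valMod (ZMod 3) (1 : ZMod 3) (↑famB1 : Set (Ty₄ (ZMod 3) → ℤ)) := by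
  have H10 : ∀ h h' : Fin 4 → Bool, binVec (ZMod 3) 1 h h' 0 ∈ valMod (ZMod 3) (1 : ZMod 3) (↑famB1 : Set (Ty₄ (ZMod 3) → ℤ)) := all_one_zero hA h3 hw hQ
  have H00 := Z_all (ZMod 3) hA (j := 1) (j' := 0) (by decide) H10
  have H30 := T_all (ZMod 3) hA (j := 1) (j' := 3) (by decide) H10
  have H20 := T_all (ZMod 3) hA (j := 0) (j' := 2) (by decide) H00
  have H02 := A_all (ZMod 3) (σ := (1 : ZMod 3)) (j := 0) (j' := 0) (u := 0) (u' := 2) (by decide) (by decide) H00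
  have H12 := Z_all (ZMod 3) hA (j := 0) (j' := 1) (by decide) H02
  have H22 := T_all (ZMod 3) hA (j := 0) (j' := 2) (by decide) H02
  have H32 := T_all (ZMod 3) hA (j := 1) (j' := 3) (by decide) H12
  have H01 := A_all (ZMod 3) (σ := (1 : ZMod 3)) (j := 0) (j' := 0) (u := 2) (u' := 1) (by decide) (by decide) H02
  have H11 := Z_all (ZMod 3) hA (j := 0) (j' := 1) (by decide) H01
  have H21 := T_all (ZMod 3) hA (j := 0) (j' := 2) (by decide) H01
  have H31 := T_all (ZMod 3) hA (j := 1) (j' := 3) (by decide) H11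
  have hu : ∀ u : ZMod 3, u = 0 ∨ u = 1 ∨ u = 2 := by decide
  rcases hu u with rfl | rfl | rfl <;> fin_cases j
  · exact H00 h h'
  · exact H10 h h'
  · exact H20 h h'
  · exact H30 h h'
  · exact H01 h h'
  · exact H11 h h'
  · exact H21 h h'
  · exact H31 h h'
  · exact H02 h h'
  · exact H12 h h'
  · exact H22 h h'
  · exact H32 h h'

/-- **The value module of `B1` contains every slot binomial** (hypothesis-free form). [folklore] -/
theorem binVec_mem_valMod (j : Fin 4) (h h' : Fin 4 → Bool) (u : ZMod 3) : binVec (ZMod 3) j h h' u ∈ valMod (ZMod 3) (1 : ZMod 3) (↑famB1 : Set (Ty₄ (ZMod 3) → ℤ)) :=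
  all_bin odd_card_zmod_three three_le_card_zmod_three one_notMem_singleton_zero card_singleton_zero j h h' u

end Trees

end

end Summit.HodgeConjecture.CorCM.Census.BinaryTetrahedral
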